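import Summits.FinalStateConjecture.FinalStateConjecture.Theorems.EIHFluxBalanceInertialRecessionStubHigherOrderSliceModel
import Summits.FinalStateConjecture.FinalStateConjecture.Theorems.EIHFluxBalanceInertialRecessionStubHigherOrderSummands

/-!
# Route EIHFluxBalance — `InertialRecession` (E′), line `SketchCleanExcision`, skeleton r13,
# stub `stub_higherOrderSlaving` (EF): the frozen field and the variation fields as sums over the
# holes, at a slice point

Helper file for the crux `stmt-FinalStateConjecture-17403`
(`Summit.FinalStateConjecture.FinalStateConjecture.Theses.EIHFluxBalance.InertialRecession`, E′),
registered stub `stub_higherOrderSlaving` (orders two and three of frozen-vacuum slaving).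

`higherOrder_sliceSums`: at a slice point `x` (`x⁰ = t`) where all painted radii are positive,
the frozen field `G₀ = Φ(t, ·)` minus the frozen OWN summand `K = boostedKerrBilin (Λ̃ᵢ t) (cᵢ t)`
(any representative frame `Λ̃ᵢ` painting the same summand) is the sum of the frozen FAR summands,
together with its first three derivatives; and the variation fields `P_m = ∂ₛᵐΦ(t, ·)` and their
derivatives are the sums over all holes of the variations of the single summands
(`…StubHigherOrderAnsatzField`, `…StubHigherOrderSummands`).

No definitions, no named facts, no `sorry`.
-/

set_option linter.dupNamespace false
set_option maxSynthPendingDepth 6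
set_option synthInstance.maxHeartbeats 200000

noncomputable section

namespace Summit.FinalStateConjecture.FinalStateConjecture.Theorems.SublinearIsFree.Slaving

open scoped Topology ContDiff BigOperators
open Filter Set Function Literature.Geometry.Lorentzian
  Summit.FinalStateConjecture.FinalStateConjecture.Theorems

set_option maxHeartbeats 6400000 in
/-- **The frozen field and the variation fields as sums over the holes.** See the module
docstring. [folklore] -/
theorem higherOrder_sliceSums (N : ℕ) (M a : Fin N → ℝ) (Λ : Fin N → ℝ → lorentzGroup)
    (ξ : Fin N → ℝ → E3)
    (hΛ : ∀ i, ContDiff ℝ ∞ (fun t ↦ ((Λ i t : E4 ≃L[ℝ] E4) : E4 →L[ℝ] E4))) (hξ : ∀ i, ContDiff ℝ ∞ (ξ i))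
    (i : Fin N) (L : lorentzGroup) {t : ℝ} {x : E4} (hx0 : x 0 = t)
    (hL : ∀ z, boostedKerrBilin L (E4.ofTimeSpace t (ξ i t)) (M i) (a i) z =
      boostedKerrBilin (Λ i t) (E4.ofTimeSpace t (ξ i t)) (M i) (a i) z)
    (hrad : ∀ j, 0 < Kerr.radius (a j) (poincareInv (Λ j t) (E4.ofTimeSpace t (ξ j t)) x)) :
    let Φ : ℝ × E4 → E4 →L[ℝ] E4 →L[ℝ] ℝ := fun q ↦ Minkowski.bilin + ∑ j, (boostedKerrBilin (Λ j q.1)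
      (E4.ofTimeSpace q.1 (ξ j q.1)) (M j) (a j) q.2 - Minkowski.bilin)
    let G₀ : E4 → E4 →L[ℝ] E4 →L[ℝ] ℝ := fun z ↦ Φ (t, z)
    let P₁ : E4 → E4 →L[ℝ] E4 →L[ℝ] ℝ := fun z ↦ deriv (fun s ↦ Φ (s, z)) t
    let P₂ : E4 → E4 →L[ℝ] E4 →L[ℝ] ℝ := fun z ↦ iteratedDeriv 2 (fun s ↦ Φ (s, z)) t
    let P₃ : E4 → E4 →L[ℝ] E4 →L[ℝ] ℝ := fun z ↦ iteratedDeriv 3 (fun s ↦ Φ (s, z)) t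
    let F₀ : Fin N → E4 → E4 →L[ℝ] E4 →L[ℝ] ℝ := fun j z ↦
      boostedKerrBilin (Λ j t) (E4.ofTimeSpace t (ξ j t)) (M j) (a j) z - Minkowski.bilin
    let Q₁ : Fin N → E4 → E4 →L[ℝ] E4 →L[ℝ] ℝ := fun j z ↦
      deriv (fun s ↦ boostedKerrBilin (Λ j s) (E4.ofTimeSpace s (ξ j s)) (M j) (a j) z) t
    let Q₂ : Fin N → E4 → E4 →L[ℝ] E4 →L[ℝ] ℝ := fun j z ↦
      iteratedDeriv 2 (fun s ↦ boostedKerrBilin (Λ j s) (E4.ofTimeSpace s (ξ j s)) (M j) (a j) z) t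
    let Q₃ : Fin N → E4 → E4 →L[ℝ] E4 →L[ℝ] ℝ := fun j z ↦
      iteratedDeriv 3 (fun s ↦ boostedKerrBilin (Λ j s) (E4.ofTimeSpace s (ξ j s)) (M j) (a j) z) t
    let K : E4 → E4 →L[ℝ] E4 →L[ℝ] ℝ := fun z ↦ boostedKerrBilin L (E4.ofTimeSpace t (ξ i t)) (M i) (a i) z
    (∀ z, G₀ z - K z = ∑ j ∈ Finset.univ.erase i, F₀ j z) ∧
    (fderiv ℝ G₀ x - fderiv ℝ K x = ∑ j ∈ Finset.univ.erase i, fderiv ℝ (F₀ j) x ∧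
      fderiv ℝ (fderiv ℝ G₀) x - fderiv ℝ (fderiv ℝ K) x =
        ∑ j ∈ Finset.univ.erase i, fderiv ℝ (fderiv ℝ (F₀ j)) x ∧
      fderiv ℝ (fderiv ℝ (fderiv ℝ G₀)) x - fderiv ℝ (fderiv ℝ (fderiv ℝ K)) x =
        ∑ j ∈ Finset.univ.erase i, fderiv ℝ (fderiv ℝ (fderiv ℝ (F₀ j))) x) ∧
    (fderiv ℝ G₀ x = ∑ j, fderiv ℝ (F₀ j) x ∧
      fderiv ℝ (fderiv ℝ G₀) x = ∑ j, fderiv ℝ (fderiv ℝ (F₀ j)) x ∧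
      fderiv ℝ (fderiv ℝ (fderiv ℝ G₀)) x = ∑ j, fderiv ℝ (fderiv ℝ (fderiv ℝ (F₀ j))) x) ∧
    (P₁ x = ∑ j, Q₁ j x ∧ fderiv ℝ P₁ x = ∑ j, fderiv ℝ (Q₁ j) x ∧
      fderiv ℝ (fderiv ℝ P₁) x = ∑ j, fderiv ℝ (fderiv ℝ (Q₁ j)) x) ∧
    (P₂ x = ∑ j, Q₂ j x ∧ fderiv ℝ P₂ x = ∑ j, fderiv ℝ (Q₂ j) x) ∧
    P₃ x = ∑ j, Q₃ j x := by
  intro Φ G₀ P₁ P₂ P₃ F₀ Q₁ Q₂ Q₃ K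
  -- the slice domain
  set Us : Set E4 := {z : E4 | ∀ j, 0 < Kerr.radius (a j) (poincareInv (Λ j t) (E4.ofTimeSpace t (ξ j t)) z)}
    with hUs
  obtain ⟨⟨hUso, hxUs, -, -, -, -⟩, -⟩ := higherOrder_sliceModel N M a Λ ξ hΛ hξ hx0 hrad
  -- smoothness of the single summands' slice fields on `Us`
  have hsum : ∀ j, ContDiffOn ℝ ∞ (F₀ j) Us ∧ ContDiffOn ℝ ∞ (Q₁ j) Us ∧ ContDiffOn ℝ ∞ (Q₂ j) Us ∧
      ContDiffOn ℝ ∞ (Q₃ j) Us := by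
    intro j
    set Uj : Set (ℝ × E4) := {q : ℝ × E4 | 0 < Kerr.radius (a j) (poincareInv (Λ j q.1)
      (E4.ofTimeSpace q.1 (ξ j q.1)) q.2)} with hUj
    have hUjo : IsOpen Uj := by
      obtain ⟨ho, -⟩ := higherOrder_contDiffOn_ansatzField 1 (fun _ ↦ M j) (fun _ ↦ a j) (fun _ ↦ Λ j)
        (fun _ ↦ ξ j) (fun _ ↦ hΛ j) (fun _ ↦ hξ j)
      have he : Uj = {q : ℝ × E4 | ∀ _i : Fin 1, 0 < Kerr.radius (a j) (poincareInv (Λ j q.1)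
          (E4.ofTimeSpace q.1 (ξ j q.1)) q.2)} := by
        ext q; simp [hUj]
      rw [he]; exact ho
    have hΦj : ContDiffOn ℝ ∞ (fun q : ℝ × E4 ↦ boostedKerrBilin (Λ j q.1) (E4.ofTimeSpace q.1 (ξ j q.1))
        (M j) (a j) q.2) Uj := fun q hq ↦
      (higherOrder_contDiffAt_summand_twoVar (M j) (a j) (hΛ j) (hξ j) hq).contDiffWithinAt
    obtain ⟨-, h0, h1, h2, h3⟩ := higherOrder_contDiffOn_sliceFields hUjo hΦj t
    have hsub : Us ⊆ {z : E4 | ((t, z) : ℝ × E4) ∈ Uj} := fun z hz ↦ hz j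
    exact ⟨(h0.mono hsub).sub contDiffOn_const, h1.mono hsub, h2.mono hsub, h3.mono hsub⟩
  -- `G₀ = η + Σ F₀ j` and `K = η + F₀ i`
  have hG₀ : G₀ = fun z ↦ Minkowski.bilin + ∑ j, F₀ j z := rfl
  have hK : K = fun z ↦ Minkowski.bilin + F₀ i z := by
    funext z
    show boostedKerrBilin L (E4.ofTimeSpace t (ξ i t)) (M i) (a i) z = Minkowski.bilin +
      (boostedKerrBilin (Λ i t) (E4.ofTimeSpace t (ξ i t)) (M i) (a i) z - Minkowski.bilin)
    rw [hL z, add_sub_cancel]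
  have hdiff : ∀ z, G₀ z - K z = ∑ j ∈ Finset.univ.erase i, F₀ j z := fun z ↦ by
    rw [hG₀, hK]
    simp only []
    rw [add_sub_add_left_eq_sub, ← Finset.sum_erase_add _ _ (Finset.mem_univ i), add_sub_cancel_right]
  -- derivatives of the sums
  obtain ⟨s1, s2, s3⟩ := higherOrder_fderiv_sum₃ (Finset.univ : Finset (Fin N)) hUso
    (fun j _ ↦ (hsum j).1) hxUs
  obtain ⟨e1, e2, e3⟩ := higherOrder_fderiv_sum₃ (Finset.univ.erase i) hUso (fun j _ ↦ (hsum j).1) hxUs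
  have hG₀' : G₀ = fun z ↦ Minkowski.bilin + (fun z ↦ ∑ j, F₀ j z) z := rfl
  have hGK : (fun z ↦ G₀ z - K z) = fun z ↦ ∑ j ∈ Finset.univ.erase i, F₀ j z := funext hdiff
  -- `D^k (G₀ - K) = D^k G₀ - D^k K` at `x`
  have hKc : ContDiffOn ℝ ∞ K Us := by
    rw [hK]; exact contDiffOn_const.add (hsum i).1
  have hG₀c : ContDiffOn ℝ ∞ G₀ Us := by
    rw [hG₀]; exact contDiffOn_const.add (ContDiffOn.sum fun j _ ↦ (hsum j).1)
  obtain ⟨m1, m2, m3⟩ := fderiv_add_jets (H₁ := G₀) (H₂ := fun z ↦ -K z) hG₀c hKc.neg hUso hxUs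
  have hGKfun : (fun z ↦ G₀ z + -K z) = fun z ↦ G₀ z - K z := by funext z; rw [sub_eq_add_neg]
  rw [hGKfun, hGK] at m1 m2 m3
  have n1 : fderiv ℝ (fun z ↦ -K z) x = -fderiv ℝ K x := fderiv_fun_neg
  have n2 : fderiv ℝ (fderiv ℝ (fun z ↦ -K z)) x = -fderiv ℝ (fderiv ℝ K) x := by
    rw [show fderiv ℝ (fun z ↦ -K z) = fun z ↦ -fderiv ℝ K z from funext fun z ↦ fderiv_fun_neg]
    exact fderiv_fun_neg
  have n3 : fderiv ℝ (fderiv ℝ (fderiv ℝ (fun z ↦ -K z))) x = -fderiv ℝ (fderiv ℝ (fderiv ℝ K)) x := by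
    rw [show fderiv ℝ (fun z ↦ -K z) = fun z ↦ -fderiv ℝ K z from funext fun z ↦ fderiv_fun_neg,
      show fderiv ℝ (fun z ↦ -fderiv ℝ K z) = fun z ↦ -fderiv ℝ (fderiv ℝ K) z from
        funext fun z ↦ fderiv_fun_neg]
    exact fderiv_fun_neg
  rw [n1, ← sub_eq_add_neg] at m1
  rw [n2, ← sub_eq_add_neg] at m2
  rw [n3, ← sub_eq_add_neg] at m3
  -- derivatives of `G₀ = η + Σ`
  obtain ⟨g1, g2, g3⟩ := fderiv_add_jets (H₁ := fun _ : E4 ↦ (Minkowski.bilin : E4 →L[ℝ] E4 →L[ℝ] ℝ))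
    (H₂ := fun z ↦ ∑ j, F₀ j z) contDiffOn_const (ContDiffOn.sum fun j _ ↦ (hsum j).1) hUso hxUs
  have z1 : fderiv ℝ (fun _ : E4 ↦ (Minkowski.bilin : E4 →L[ℝ] E4 →L[ℝ] ℝ)) = 0 :=
    fderiv_fun_const (𝕜 := ℝ) (E := E4) (Minkowski.bilin : E4 →L[ℝ] E4 →L[ℝ] ℝ)
  have z2 : fderiv ℝ (0 : E4 → E4 →L[ℝ] E4 →L[ℝ] E4 →L[ℝ] ℝ) = 0 := fderiv_zero
  have z3 : fderiv ℝ (0 : E4 → E4 →L[ℝ] E4 →L[ℝ] E4 →L[ℝ] E4 →L[ℝ] ℝ) = 0 := fderiv_zero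
  rw [z1, Pi.zero_apply, zero_add] at g1
  rw [z1, z2, Pi.zero_apply, zero_add] at g2
  rw [z1, z2, z3, Pi.zero_apply, zero_add] at g3
  -- the variation fields as sums on `Us`
  have hP : ∀ {m : ℕ}, 0 < m → ∀ z ∈ Us, iteratedDeriv m (fun s ↦ Φ (s, z)) t =
      ∑ j, iteratedDeriv m (fun s ↦ boostedKerrBilin (Λ j s) (E4.ofTimeSpace s (ξ j s)) (M j) (a j) z) t :=
    fun hm z hz ↦ higherOrder_iteratedDeriv_ansatzField N M a Λ ξ hΛ hξ hz hm
  have hP₁eq : EqOn P₁ (fun z ↦ ∑ j, Q₁ j z) Us := fun z hz ↦ by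
    show deriv (fun s ↦ Φ (s, z)) t = ∑ j, deriv (fun s ↦ boostedKerrBilin (Λ j s)
      (E4.ofTimeSpace s (ξ j s)) (M j) (a j) z) t
    have h := hP one_pos z hz
    simpa only [iteratedDeriv_one] using h
  have hP₂eq : EqOn P₂ (fun z ↦ ∑ j, Q₂ j z) Us := fun z hz ↦ hP (by norm_num) z hz
  have hP₃eq : EqOn P₃ (fun z ↦ ∑ j, Q₃ j z) Us := fun z hz ↦ hP (by norm_num) z hz
  obtain ⟨q1, q2, -⟩ := higherOrder_fderiv_sum₃ (Finset.univ : Finset (Fin N)) hUso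
    (fun j _ ↦ (hsum j).2.1) hxUs
  obtain ⟨r1, -, -⟩ := higherOrder_fderiv_sum₃ (Finset.univ : Finset (Fin N)) hUso
    (fun j _ ↦ (hsum j).2.2.1) hxUs
  have hev₁ : P₁ =ᶠ[𝓝 x] fun z ↦ ∑ j, Q₁ j z := Filter.eventually_of_mem (hUso.mem_nhds hxUs) hP₁eq
  have hev₂ : P₂ =ᶠ[𝓝 x] fun z ↦ ∑ j, Q₂ j z := Filter.eventually_of_mem (hUso.mem_nhds hxUs) hP₂eq
  refine ⟨hdiff, ⟨?_, ?_, ?_⟩, ⟨?_, ?_, ?_⟩, ⟨hP₁eq hxUs, ?_, ?_⟩, ⟨hP₂eq hxUs, ?_⟩, hP₃eq hxUs⟩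
  · rw [← m1, e1]
  · rw [← m2, e2]
  · rw [← m3, e3]
  · rw [hG₀', g1, s1]
  · rw [hG₀', g2, s2]
  · rw [hG₀', g3, s3]
  · rw [hev₁.fderiv_eq, q1]
  · have h : fderiv ℝ P₁ =ᶠ[𝓝 x] fderiv ℝ (fun z ↦ ∑ j, Q₁ j z) := hev₁.fderiv
    rw [h.fderiv_eq, q2]
  · rw [hev₂.fderiv_eq, r1]

/-- **Registered one-line carrier form** (`higherOrder_sliceSums_EF`): the third-variation part
of `higherOrder_sliceSums`. [folklore] -/
theorem higherOrder_sliceSums_EF : open Literature.Geometry.Lorentzian in ∀ (N : ℕ) (M a : Fin N → ℝ) (Λ : Fin N → ℝ → lorentzGroup) (ξ : Fin N → ℝ → E3), (∀ i, ContDiff ℝ ((⊤ : ℕ∞) : WithTop ℕ∞) (fun t ↦ ((Λ i t : E4 ≃L[ℝ] E4) : E4 →L[ℝ] E4))) → (∀ i, ContDiff ℝ ((⊤ : ℕ∞) : WithTop ℕ∞) (ξ i)) → ∀ (i : Fin N) (L : lorentzGroup) {t : ℝ} {x : E4}, x 0 = t → (∀ z, boostedKerrBilin L (E4.ofTimeSpace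 t (ξ i t)) (M i) (a i) z = boostedKerrBilin (Λ i t) (E4.ofTimeSpace t (ξ i t)) (M i) (a i) z) → (∀ j, 0 < Kerr.radius (a j) (poincareInv (Λ j t) (E4.ofTimeSpace t (ξ j t)) x)) → iteratedDeriv 3 (fun s ↦ (fun q : ℝ × E4 ↦ Minkowski.bilin + ∑ j, (boostedKerrBilin (Λ j q.1) (E4.ofTimeSpace q.1 (ξ j q.1)) (M j) (a j) q.2 - Minkowski.bilin)) (s, x)) t = ∑ j, iteratedDeriv 3 (fun s ↦ boostedKerrBilin (Λ j s) (E4.ofTimeSpace s (ξ j s)) (M j) (a j) x) t :=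
  fun N M a Λ ξ hΛ hξ i L _ _ hx0 hL hrad ↦ (higherOrder_sliceSums N M a Λ ξ hΛ hξ i L hx0 hL hrad).2.2.2.2.2

end Summit.FinalStateConjecture.FinalStateConjecture.Theorems.SublinearIsFree.Slaving

end
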